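import Summits.Ventures.WeilGRH.TwoPrimeReflectionRungsClasses
import Summits.Ventures.WeilGRH.ConreyRowBridge
import HarnessLib

/-!
# GRH arm (rh-explicit, venture WeilGRH): the two-prime reflection rungs `59/100` and `log 2` for NAMED
  census characters of conductor `≤ 20` (part 1: `χ(2) ∈ {−1, ±i}`, `χ(3) ∈ {0, 1}`)

Cell `rh-explicit`, WEIL TRACK — GRH ARM (census / typing seat weil-grh-1; asked by weil-grh-2, INBOX
2026-08-22T10:59:53Z).  weil-grh-2's `TwoPrimeReflectionRungsClasses.lean` proves the rungs `59/100` and `log 2`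
under hypotheses on the two values `χ(2)`, `χ(3)`; this file DISCHARGES those hypotheses for the characters of
the census `DirichletCharacterCensus20.lean` through the bridge `ConreyRowBridge.lean`
(`χ(k) = ζ_ord^{E[k]}`, `toChar_apply_natCast`), so that each `(q, χ, t)` cell below is a tree theorem about a
NAMED primitive character `(censusRow q n).toChar _` (Conrey label `q.n`):

| class (conj.) | `χ(2)` | `χ(3)` | rung(s) | via |
|---|---|---|---|---|
| 11.10 | −1 | 1 | 59/100, log 2 | `…_of_chi_two_neg_one_chi_three_one` |
| 13.12 | −1 | 1 | 59/100, log 2 | same |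
| 13.5 / 13.8 | ∓i | 1 | log 2 (⊇ 59/100) | `…_log_two_of_chi_three_one` |
| 15.2 / 15.8 | ∓i | 0 | 59/100 | `…_fiftynine_of_three_dvd_of_two_le` |
| 17.4 / 17.13 | −1 | ±i | 59/100 | `…_fiftynine_of_chi_two_neg_one` |
| 19.18 | −1 | −1 | 59/100 | same |
| 20.19 | 0 | 1 | 59/100, log 2 | `…_of_trivial_at_three` (TwoPrimeReflectionRungs) |

`censusRow q n` picks the row of label `q.n` out of `census20` (one definition, docstring'd; `NeZero` instance
for its modulus).  Part 2 (`CensusTwoPrimeRungs2.lean`) treats the classes keyed by metric facts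
(`17.2/17.9`, `17.3/17.6`, `17.10/17.12`, `19.6/19.16`, `19.7/19.11`, `19.8/19.12`, `19.9/19.17`, `19.14/19.15`).
No named facts; RH/GRH-free.
-/

noncomputable section

open Complex
open scoped Real ComplexConjugate

namespace Summit.Ventures.WeilGRH

open Literature.NumberTheory.LFunctions

/-! ## Picking a census row by its Conrey label -/

/-- **The census row of Conrey label `q.n`** (the first row of `census20` with modulus `q` and index `n`;
the row `3.2` if there is none — never used). -/
def censusRow (q n : ℕ) : ConreyRow :=
  ((census20.filter fun R ↦ R.q == q && R.n == n).head?).getD ⟨3, 2, 2, 1, [0, 0, 1]⟩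

/-- Every census row, and the fallback row, has modulus `≥ 3`; so `(censusRow q n).q ≠ 0`. -/
instance censusRow_neZero (q n : ℕ) : NeZero (censusRow q n).q := by
  refine ⟨fun h0 ↦ ?_⟩
  have hall : ∀ R ∈ census20, 3 ≤ R.q := by decide
  unfold censusRow at h0
  cases hl : (census20.filter fun R ↦ R.q == q && R.n == n).head? with
  | none => rw [hl] at h0; simp at h0
  | some R =>
    rw [hl] at h0
    have hR : R ∈ census20 := (List.mem_filter.1 (List.mem_of_mem_head? (Option.mem_def.2 hl))).1
    have := hall R hR
    simp only [Option.getD_some] at h0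
    omega

/-! ## Values of the census characters: roots of unity -/

/-- `ζ_ord^e = exp(2π e/ord · i)` as `cexp (θ I)` with a REAL angle. -/
theorem ConreyRow.zeta_pow_eq_cexp (R : ConreyRow) (e : ℕ) :
    R.zeta ^ e = cexp (((2 * π * e / R.ord : ℝ) : ℂ) * I) := by
  rw [ConreyRow.zeta, ← Complex.exp_nat_mul]
  congr 1
  push_cast
  ring

/-- `‖1 − e^{iθ}‖² = 2 − 2cos θ`. -/
theorem normSq_one_sub_cexp_mul_I (θ : ℝ) : ‖1 - cexp ((θ : ℂ) * I)‖ ^ 2 = 2 - 2 * Real.cos θ := by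
  rw [normSq_one_sub_eq, Complex.exp_ofReal_mul_I_re, Complex.exp_ofReal_mul_I_im]
  nlinarith [Real.cos_sq_add_sin_sq θ]

/-- `e^{iπ} = −1` in the real-angle form. -/
theorem cexp_pi_mul_I' : cexp (((π : ℝ) : ℂ) * I) = -1 := by
  exact_mod_cast Complex.exp_pi_mul_I

/-- `‖1 − e^{i·3π/2}‖² = 2` (`e^{3πi/2} = −i`). -/
theorem normSq_one_sub_cexp_three_pi_div_two : ‖1 - cexp (((3 * π / 2 : ℝ) : ℂ) * I)‖ ^ 2 = 2 := by
  rw [normSq_one_sub_cexp_mul_I, show 3 * π / 2 = π / 2 + π by ring, Real.cos_add_pi, Real.cos_pi_div_two]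
  ring

/-- `‖1 − e^{i·π/2}‖² = 2` (`e^{πi/2} = i`). -/
theorem normSq_one_sub_cexp_pi_div_two : ‖1 - cexp (((π / 2 : ℝ) : ℂ) * I)‖ ^ 2 = 2 := by
  rw [normSq_one_sub_cexp_mul_I, Real.cos_pi_div_two]; ring

/-- `(2 : ZMod q)` is the cast of the natural number `2`. -/
private theorem two_eq_natCast (q : ℕ) : (2 : ZMod q) = ((2 : ℕ) : ZMod q) := by norm_cast

/-- `(3 : ZMod q)` is the cast of the natural number `3`. -/
private theorem three_eq_natCast (q : ℕ) : (3 : ZMod q) = ((3 : ℕ) : ZMod q) := by norm_cast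

/-- `59/100 ≤ log 2`. -/
theorem fiftynine_le_log_two : (59 / 100 : ℝ) ≤ Real.log 2 := by linarith [Real.log_two_gt_d9]

/-! ## 11.10 and 13.12: `χ(2) = −1`, `χ(3) = 1` -/

/-- `χ_{11.10}(2) = −1`. -/
theorem census_11_10_two : (censusRow 11 10).toChar (census20_check _ (by decide)) (2 : ZMod _) = -1 := by
  rw [two_eq_natCast, ConreyRow.toChar_apply_natCast, if_pos (by decide), ConreyRow.zeta_pow_eq_cexp,
    show (censusRow 11 10).e 2 = 1 by decide, show (censusRow 11 10).ord = 2 by decide,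
    show (2 * π * ((1 : ℕ) : ℝ) / ((2 : ℕ) : ℝ) : ℝ) = π by push_cast; ring]
  exact cexp_pi_mul_I'

/-- `χ_{11.10}(3) = 1`. -/
theorem census_11_10_three : (censusRow 11 10).toChar (census20_check _ (by decide)) (3 : ZMod _) = 1 := by
  rw [three_eq_natCast, ConreyRow.toChar_apply_natCast, if_pos (by decide),
    show (censusRow 11 10).e 3 = 0 by decide, pow_zero]

/-- **Cell 11.10 at `59/100`**: `WeilPositivityOnChar χ_{11.10} (59/100)` (χ_{11.10} = `(−11/·)`). -/
theorem weilPositivityOnChar_fiftynine_census_11_10 :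
    WeilPositivityOnChar ((censusRow 11 10).toChar (census20_check _ (by decide))) (59 / 100) :=
  weilPositivityOnChar_fiftynine_of_chi_two_neg_one_chi_three_one (by decide) _
    census_11_10_two census_11_10_three

/-- **Cell 11.10 at `log 2`**. -/
theorem weilPositivityOnChar_log_two_census_11_10 :
    WeilPositivityOnChar ((censusRow 11 10).toChar (census20_check _ (by decide))) (Real.log 2) :=
  weilPositivityOnChar_log_two_of_chi_two_neg_one_chi_three_one (by decide) _
    census_11_10_two census_11_10_three

/-- `χ_{13.12}(2) = −1`. -/
theorem census_13_12_two : (censusRow 13 12).toChar (census20_check _ (by decide)) (2 : ZMod _) = -1 := by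
  rw [two_eq_natCast, ConreyRow.toChar_apply_natCast, if_pos (by decide), ConreyRow.zeta_pow_eq_cexp,
    show (censusRow 13 12).e 2 = 1 by decide, show (censusRow 13 12).ord = 2 by decide,
    show (2 * π * ((1 : ℕ) : ℝ) / ((2 : ℕ) : ℝ) : ℝ) = π by push_cast; ring]
  exact cexp_pi_mul_I'

/-- `χ_{13.12}(3) = 1`. -/
theorem census_13_12_three : (censusRow 13 12).toChar (census20_check _ (by decide)) (3 : ZMod _) = 1 := by
  rw [three_eq_natCast, ConreyRow.toChar_apply_natCast, if_pos (by decide),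
    show (censusRow 13 12).e 3 = 0 by decide, pow_zero]

/-- **Cell 13.12 at `59/100`** (χ_{13.12} = `(13/·)`). -/
theorem weilPositivityOnChar_fiftynine_census_13_12 :
    WeilPositivityOnChar ((censusRow 13 12).toChar (census20_check _ (by decide))) (59 / 100) :=
  weilPositivityOnChar_fiftynine_of_chi_two_neg_one_chi_three_one (by decide) _
    census_13_12_two census_13_12_three

/-- **Cell 13.12 at `log 2`**. -/
theorem weilPositivityOnChar_log_two_census_13_12 :
    WeilPositivityOnChar ((censusRow 13 12).toChar (census20_check _ (by decide))) (Real.log 2) :=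
  weilPositivityOnChar_log_two_of_chi_two_neg_one_chi_three_one (by decide) _
    census_13_12_two census_13_12_three

/-! ## 13.5 / 13.8: `χ(2) = ∓i`, `χ(3) = 1` -/

/-- `‖1 − χ_{13.5}(2)‖² = 2` (`χ_{13.5}(2) = −i`). -/
theorem census_13_5_two : ‖1 - (censusRow 13 5).toChar (census20_check _ (by decide)) (2 : ZMod _)‖ ^ 2 = 2 := by
  rw [two_eq_natCast, ConreyRow.toChar_apply_natCast, if_pos (by decide), ConreyRow.zeta_pow_eq_cexp,
    show (censusRow 13 5).e 2 = 3 by decide, show (censusRow 13 5).ord = 4 by decide,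
    show (2 * π * ((3 : ℕ) : ℝ) / ((4 : ℕ) : ℝ) : ℝ) = 3 * π / 2 by push_cast; ring]
  exact normSq_one_sub_cexp_three_pi_div_two

/-- `χ_{13.5}(3) = 1`. -/
theorem census_13_5_three : (censusRow 13 5).toChar (census20_check _ (by decide)) (3 : ZMod _) = 1 := by
  rw [three_eq_natCast, ConreyRow.toChar_apply_natCast, if_pos (by decide),
    show (censusRow 13 5).e 3 = 0 by decide, pow_zero]

/-- **Cell 13.5 at `log 2`** (hence at every `a ≤ log 2`, in particular `59/100`). -/
theorem weilPositivityOnChar_log_two_census_13_5 :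
    WeilPositivityOnChar ((censusRow 13 5).toChar (census20_check _ (by decide))) (Real.log 2) :=
  weilPositivityOnChar_log_two_of_chi_three_one (by decide) _ census_13_5_two.symm.le census_13_5_three

/-- **Cell 13.5 at `59/100`**. -/
theorem weilPositivityOnChar_fiftynine_census_13_5 :
    WeilPositivityOnChar ((censusRow 13 5).toChar (census20_check _ (by decide))) (59 / 100) :=
  weilPositivityOnChar_log_two_census_13_5.mono fiftynine_le_log_two

/-- `‖1 − χ_{13.8}(2)‖² = 2` (`χ_{13.8}(2) = i`). -/
theorem census_13_8_two : ‖1 - (censusRow 13 8).toChar (census20_check _ (by decide)) (2 : ZMod _)‖ ^ 2 = 2 := by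
  rw [two_eq_natCast, ConreyRow.toChar_apply_natCast, if_pos (by decide), ConreyRow.zeta_pow_eq_cexp,
    show (censusRow 13 8).e 2 = 1 by decide, show (censusRow 13 8).ord = 4 by decide,
    show (2 * π * ((1 : ℕ) : ℝ) / ((4 : ℕ) : ℝ) : ℝ) = π / 2 by push_cast; ring]
  exact normSq_one_sub_cexp_pi_div_two

/-- `χ_{13.8}(3) = 1`. -/
theorem census_13_8_three : (censusRow 13 8).toChar (census20_check _ (by decide)) (3 : ZMod _) = 1 := by
  rw [three_eq_natCast, ConreyRow.toChar_apply_natCast, if_pos (by decide),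
    show (censusRow 13 8).e 3 = 0 by decide, pow_zero]

/-- **Cell 13.8 at `log 2`**. -/
theorem weilPositivityOnChar_log_two_census_13_8 :
    WeilPositivityOnChar ((censusRow 13 8).toChar (census20_check _ (by decide))) (Real.log 2) :=
  weilPositivityOnChar_log_two_of_chi_three_one (by decide) _ census_13_8_two.symm.le census_13_8_three

/-- **Cell 13.8 at `59/100`**. -/
theorem weilPositivityOnChar_fiftynine_census_13_8 :
    WeilPositivityOnChar ((censusRow 13 8).toChar (census20_check _ (by decide))) (59 / 100) :=
  weilPositivityOnChar_log_two_census_13_8.mono fiftynine_le_log_two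

/-! ## 15.2 / 15.8: `3 ∣ 15`, `χ(2) = ∓i` -/

/-- `‖1 − χ_{15.2}(2)‖² = 2`. -/
theorem census_15_2_two : ‖1 - (censusRow 15 2).toChar (census20_check _ (by decide)) (2 : ZMod _)‖ ^ 2 = 2 := by
  rw [two_eq_natCast, ConreyRow.toChar_apply_natCast, if_pos (by decide), ConreyRow.zeta_pow_eq_cexp,
    show (censusRow 15 2).e 2 = 3 by decide, show (censusRow 15 2).ord = 4 by decide,
    show (2 * π * ((3 : ℕ) : ℝ) / ((4 : ℕ) : ℝ) : ℝ) = 3 * π / 2 by push_cast; ring]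
  exact normSq_one_sub_cexp_three_pi_div_two

/-- **Cell 15.2 at `59/100`**. -/
theorem weilPositivityOnChar_fiftynine_census_15_2 :
    WeilPositivityOnChar ((censusRow 15 2).toChar (census20_check _ (by decide))) (59 / 100) :=
  weilPositivityOnChar_fiftynine_of_three_dvd_of_two_le (by decide) (by decide) _ census_15_2_two.symm.le

/-- `‖1 − χ_{15.8}(2)‖² = 2`. -/
theorem census_15_8_two : ‖1 - (censusRow 15 8).toChar (census20_check _ (by decide)) (2 : ZMod _)‖ ^ 2 = 2 := by
  rw [two_eq_natCast, ConreyRow.toChar_apply_natCast, if_pos (by decide), ConreyRow.zeta_pow_eq_cexp,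
    show (censusRow 15 8).e 2 = 1 by decide, show (censusRow 15 8).ord = 4 by decide,
    show (2 * π * ((1 : ℕ) : ℝ) / ((4 : ℕ) : ℝ) : ℝ) = π / 2 by push_cast; ring]
  exact normSq_one_sub_cexp_pi_div_two

/-- **Cell 15.8 at `59/100`**. -/
theorem weilPositivityOnChar_fiftynine_census_15_8 :
    WeilPositivityOnChar ((censusRow 15 8).toChar (census20_check _ (by decide))) (59 / 100) :=
  weilPositivityOnChar_fiftynine_of_three_dvd_of_two_le (by decide) (by decide) _ census_15_8_two.symm.le

/-! ## 17.4 / 17.13 / 19.18: `χ(2) = −1` -/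

/-- `χ_{17.4}(2) = −1`. -/
theorem census_17_4_two : (censusRow 17 4).toChar (census20_check _ (by decide)) (2 : ZMod _) = -1 := by
  rw [two_eq_natCast, ConreyRow.toChar_apply_natCast, if_pos (by decide), ConreyRow.zeta_pow_eq_cexp,
    show (censusRow 17 4).e 2 = 2 by decide, show (censusRow 17 4).ord = 4 by decide,
    show (2 * π * ((2 : ℕ) : ℝ) / ((4 : ℕ) : ℝ) : ℝ) = π by push_cast; ring]
  exact cexp_pi_mul_I'

/-- **Cell 17.4 at `59/100`**. -/
theorem weilPositivityOnChar_fiftynine_census_17_4 :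
    WeilPositivityOnChar ((censusRow 17 4).toChar (census20_check _ (by decide))) (59 / 100) :=
  weilPositivityOnChar_fiftynine_of_chi_two_neg_one (by decide) _ census_17_4_two

/-- `χ_{17.13}(2) = −1`. -/
theorem census_17_13_two : (censusRow 17 13).toChar (census20_check _ (by decide)) (2 : ZMod _) = -1 := by
  rw [two_eq_natCast, ConreyRow.toChar_apply_natCast, if_pos (by decide), ConreyRow.zeta_pow_eq_cexp,
    show (censusRow 17 13).e 2 = 2 by decide, show (censusRow 17 13).ord = 4 by decide,
    show (2 * π * ((2 : ℕ) : ℝ) / ((4 : ℕ) : ℝ) : ℝ) = π by push_cast; ring]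
  exact cexp_pi_mul_I'

/-- **Cell 17.13 at `59/100`**. -/
theorem weilPositivityOnChar_fiftynine_census_17_13 :
    WeilPositivityOnChar ((censusRow 17 13).toChar (census20_check _ (by decide))) (59 / 100) :=
  weilPositivityOnChar_fiftynine_of_chi_two_neg_one (by decide) _ census_17_13_two

/-- `χ_{19.18}(2) = −1`. -/
theorem census_19_18_two : (censusRow 19 18).toChar (census20_check _ (by decide)) (2 : ZMod _) = -1 := by
  rw [two_eq_natCast, ConreyRow.toChar_apply_natCast, if_pos (by decide), ConreyRow.zeta_pow_eq_cexp,
    show (censusRow 19 18).e 2 = 1 by decide, show (censusRow 19 18).ord = 2 by decide,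
    show (2 * π * ((1 : ℕ) : ℝ) / ((2 : ℕ) : ℝ) : ℝ) = π by push_cast; ring]
  exact cexp_pi_mul_I'

/-- **Cell 19.18 at `59/100`** (χ_{19.18} = `(−19/·)`). -/
theorem weilPositivityOnChar_fiftynine_census_19_18 :
    WeilPositivityOnChar ((censusRow 19 18).toChar (census20_check _ (by decide))) (59 / 100) :=
  weilPositivityOnChar_fiftynine_of_chi_two_neg_one (by decide) _ census_19_18_two

/-! ## 20.19: `χ(3) = 1` (weil-grh-2's `TwoPrimeReflectionRungs.lean`, `δ = 0`) -/

/-- `χ_{20.19}(3) = 1`. -/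
theorem census_20_19_three : (censusRow 20 19).toChar (census20_check _ (by decide)) (3 : ZMod _) = 1 := by
  rw [three_eq_natCast, ConreyRow.toChar_apply_natCast, if_pos (by decide),
    show (censusRow 20 19).e 3 = 0 by decide, pow_zero]

/-- **Cell 20.19 at `59/100`** (χ_{20.19} = `(−20/·)` = `(−5/·)`, `χ(3) = 1`). -/
theorem weilPositivityOnChar_fiftynine_census_20_19 :
    WeilPositivityOnChar ((censusRow 20 19).toChar (census20_check _ (by decide))) (59 / 100) :=
  weilPositivityOnChar_fiftynine_of_trivial_at_three (by decide) _ census_20_19_three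

/-- **Cell 20.19 at `log 2`**. -/
theorem weilPositivityOnChar_log_two_census_20_19 :
    WeilPositivityOnChar ((censusRow 20 19).toChar (census20_check _ (by decide))) (Real.log 2) :=
  weilPositivityOnChar_log_two_of_trivial_at_three (by decide) _ census_20_19_three

end Summit.Ventures.WeilGRH

end
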